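import Literature.NumberTheory.Automorphic.BianchiOrdinaryClassicality
import Literature.NumberTheory.Automorphic.CuspidalCohomologyHeckeEigenvalue
import HarnessLib

/-!
# `bianchi_interiorEigenclass_isCuspidal` reduced to the Eichler–Shimura–Harder comparison

Topic `NumberTheory/Automorphic`; namespace `Literature.NumberTheory.Automorphic`. One theorem (no
definition, no named fact, no `sorry`), a sibling of `BianchiOrdinaryClassicalityProofs`.

`bianchi_interiorEigenclass_isCuspidal_of_comparison`: the named fact
`bianchi_interiorEigenclass_isCuspidal` (Harder 1987: interior Hecke eigenclasses of Bianchi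
groups are cuspidal automorphic, with the Satake normalisation `a_{w,1} = q_w^{1/2} e₁(α_w)`,
`a_{w,2} = e₂(α_w)`) follows from

* `hESH` — the Eichler–Shimura–Harder/Franke COMPARISON in the tree's vocabulary: a non-zero
  interior eigenclass of `H^q(X_U, M̃_wt)` is matched by a non-zero `U`-invariant class of
  `H^q(𝔤_∞, K_∞; π₀ ⊗ E_wt(ℂ))` (`CuspidalAutomorphicRepData.cohomologyWtLevel`) for a cuspidal `π₀`
  of infinity type `cohomologicalInfinityType 2 F wt^∨`, with the same `T_{w,1}, T_{w,2}`-eigenvalues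
  at almost all `w` (Harder 1987, §3 (3.1.1)–(3.2.5); Borel–Wallach VII; the de Rham /
  Borel–Serre / `L²` comparison theory, absent from the tree), and
* `hFl` — the tree's per-`π` Flath statement `Flath1979_heckeOperator_ofLocal_sub_smul_mem`
  (a named fact of `AutomorphicRepsGL…`, discharged separately),

by the proved theorem `CuspidalAutomorphicRepData.exists_finite_heckeTWt_eq_satake_smul` (Hecke
operators act on `H^q(𝔤, K_∞; π₀ ⊗ E_wt)^U` by the Satake scalars) and the arithmetic
`(q_w^{1/2})^{1·(2-1)} = q_w^{1/2}`, `(q_w^{1/2})^{2·0} = 1`.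

## References
* [Harder1987] G. Harder, *Eisenstein cohomology of arithmetic groups. The case GL₂*, §3.
* [FlathCorvallis1979] D. Flath, Corvallis 1979, Thm. 3.
* [BorelWallach2000] A. Borel, N. Wallach, 2nd ed., I §5.1, VII §2.
-/

noncomputable section

namespace Literature.NumberTheory.Automorphic

section Reduction

open BigHeckeGLn IsDedekindDomain
open scoped Classical
open scoped _root_.NumberField
open _root_.NumberField

set_option maxHeartbeats 800000 in
/-- **Reduction of `bianchi_interiorEigenclass_isCuspidal` to the comparison theorem.**
Hypothesis `hESH` is the Eichler–Shimura–Harder/Franke comparison for `GL₂` over an imaginary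
quadratic field in the tree's vocabulary — a non-zero interior Hecke eigenclass of
`H^q(X_U, M̃_wt)` is matched by a non-zero `U`-invariant class of `H^q(𝔤, K_∞; π₀ ⊗ E_wt(ℂ))` for a
CUSPIDAL `π₀` of the right infinity type with the same `T_{w,1}, T_{w,2}`-eigenvalues at almost all
`w` (Harder 1987, §3: (3.1.1)–(3.2.5), Borel–Wallach VII; absent from the tree) — and `hFl` is the
tree's per-`π` Flath statement (unramified Hecke operators act on `π^{K(𝔫)}` by the Satake
scalars).  Everything else — Hecke operators on `(𝔤, K_∞)`-cohomology, the level `K(𝔫)`, good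
places, `T_{w,j} = H^q(∑ r(ι_w y) ⊗ 1)`, the averaging argument and the Satake normalisation
`a_{w,1} = q_w^{1/2} e₁(α)`, `a_{w,2} = e₂(α)` for `n = 2` — is proved
(`CuspidalAutomorphicRepData.exists_finite_heckeTWt_eq_satake_smul`).
[cite: Harder1987, §3] [cite: FlathCorvallis1979, Thm. 3] [cite: BorelWallach2000, I §5.1, VII §2] -/
theorem bianchi_interiorEigenclass_isCuspidal_of_comparison
    (hESH : ∀ (F : Type) [Field F] [NumberField F], NumberField.IsTotallyComplex F →
      Module.finrank ℚ F = 2 →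
      ∀ (hcpt : isCompact_glFiniteIntegralLevel 2 F) (E : Type) [Field E] (ι : E ≃+* ℂ)
        (wt : Fin 2 → ℤ), Literature.NumberTheory.DiophantineGeometry.Weight.IsDominant wt →
      ∀ (U : Subgroup (FiniteAdelicGL 2 F)), IsOpen (U : Set (FiniteAdelicGL 2 F)) →
        IsCompact (U : Set (FiniteAdelicGL 2 F)) →
      ∀ (q : ℕ) (ξ : ParallelWeight.cohomology E F 2 wt U q),
        ξ ∈ ParallelWeight.interiorCohomology E F 2 wt U q → ξ ≠ 0 →
      ∀ (a : HeightOneSpectrum (𝓞 F) → ℕ → E),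
        (∀ᶠ w in Filter.cofinite, ParallelWeight.heckeT E F 2 wt U q w 1 ξ = a w 1 • ξ ∧
          ParallelWeight.heckeT E F 2 wt U q w 2 ξ = a w 2 • ξ) →
        ∃ π₀ : CuspidalAutomorphicRepData 2 F hcpt,
          π₀.1.HasInfinityType
              (Literature.Barriers.Langlands.cohomologicalInfinityType 2 F
                (Literature.NumberTheory.DiophantineGeometry.Weight.dual wt)) ∧
          ∃ ξ' : π₀.cohomologyWt wt q, ξ' ∈ π₀.cohomologyWtLevel wt U q ∧ ξ' ≠ 0 ∧
            ∀ᶠ w in Filter.cofinite,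
              π₀.heckeTWt wt U q w 1 ξ' = ι (a w 1) • ξ' ∧ π₀.heckeTWt wt U q w 2 ξ' = ι (a w 2) • ξ')
    (hFl : ∀ (F : Type) [Field F] [NumberField F] (hcpt : isCompact_glFiniteIntegralLevel 2 F)
      (π₀ : CuspidalAutomorphicRepData 2 F hcpt), π₀.1.Flath1979_heckeOperator_ofLocal_sub_smul_mem) :
    bianchi_interiorEigenclass_isCuspidal := by
  intro F _ _ hF hdeg hcpt E _ ι wt hwt U hUo hUc q ξ hξ hξ0 a ha
  obtain ⟨π₀, hinf, ξ', hξ'U, hξ'0, hev⟩ := hESH F hF hdeg hcpt E ι wt hwt U hUo hUc q ξ hξ hξ0 a ha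
  refine ⟨π₀, hinf, ?_⟩
  obtain ⟨S₀, hS₀, hsat⟩ :=
    π₀.exists_finite_heckeTWt_eq_satake_smul wt U (hFl F hcpt π₀) q hUo hUc
  have hcof : ∀ᶠ w in Filter.cofinite, w ∉ S₀ := by
    rw [Filter.eventually_cofinite]
    exact hS₀.subset fun w hw => not_not.1 hw
  filter_upwards [hev, hcof] with w hw hwS
  obtain ⟨α, hα, hj⟩ := hsat w hwS
  have hscalar : ∀ {c d : ℂ}, c • ξ' = d • ξ' → c = d := by
    intro c d hcd
    have h0 : (c - d) • ξ' = 0 := by rw [sub_smul, hcd, sub_self]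
    exact sub_eq_zero.1 ((smul_eq_zero.1 h0).resolve_right hξ'0)
  refine ⟨α, hα, ?_, ?_⟩
  · have e := hscalar (hw.1.symm.trans (hj 1 (by norm_num) ξ' hξ'U))
    rw [e]
    norm_num
  · have e := hscalar (hw.2.symm.trans (hj 2 le_rfl ξ' hξ'U))
    rw [e]
    norm_num


set_option maxHeartbeats 400000 in
/-- **`bianchi_interiorEigenclass_isCuspidal` from the comparison ALONE.** The Flath hypothesis of
`bianchi_interiorEigenclass_isCuspidal_of_comparison` is the tree's theorem
`AutomorphicRepData.Flath1979_heckeOperator_ofLocal_sub_smul_mem_holds`, so the named fact is now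
reduced to exactly one statement absent from the tree: the Eichler–Shimura–Harder comparison `hESH`
(Harder 1987, §3 (3.1.1)–(3.2.5); Borel–Wallach VII §2). [cite: Harder1987, §3]
[cite: FlathCorvallis1979, Thm. 3] -/
theorem bianchi_interiorEigenclass_isCuspidal_of_comparison'
    (hESH : ∀ (F : Type) [Field F] [NumberField F], NumberField.IsTotallyComplex F →
      Module.finrank ℚ F = 2 →
      ∀ (hcpt : isCompact_glFiniteIntegralLevel 2 F) (E : Type) [Field E] (ι : E ≃+* ℂ)
        (wt : Fin 2 → ℤ), Literature.NumberTheory.DiophantineGeometry.Weight.IsDominant wt →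
      ∀ (U : Subgroup (FiniteAdelicGL 2 F)), IsOpen (U : Set (FiniteAdelicGL 2 F)) →
        IsCompact (U : Set (FiniteAdelicGL 2 F)) →
      ∀ (q : ℕ) (ξ : ParallelWeight.cohomology E F 2 wt U q),
        ξ ∈ ParallelWeight.interiorCohomology E F 2 wt U q → ξ ≠ 0 →
      ∀ (a : HeightOneSpectrum (𝓞 F) → ℕ → E),
        (∀ᶠ w in Filter.cofinite, ParallelWeight.heckeT E F 2 wt U q w 1 ξ = a w 1 • ξ ∧
          ParallelWeight.heckeT E F 2 wt U q w 2 ξ = a w 2 • ξ) →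
        ∃ π₀ : CuspidalAutomorphicRepData 2 F hcpt,
          π₀.1.HasInfinityType
              (Literature.Barriers.Langlands.cohomologicalInfinityType 2 F
                (Literature.NumberTheory.DiophantineGeometry.Weight.dual wt)) ∧
          ∃ ξ' : π₀.cohomologyWt wt q, ξ' ∈ π₀.cohomologyWtLevel wt U q ∧ ξ' ≠ 0 ∧
            ∀ᶠ w in Filter.cofinite,
              π₀.heckeTWt wt U q w 1 ξ' = ι (a w 1) • ξ' ∧ π₀.heckeTWt wt U q w 2 ξ' = ι (a w 2) • ξ') :
    bianchi_interiorEigenclass_isCuspidal :=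
  bianchi_interiorEigenclass_isCuspidal_of_comparison hESH fun _ _ _ _ π₀ =>
    AutomorphicRepData.Flath1979_heckeOperator_ofLocal_sub_smul_mem_holds π₀.1

end Reduction

end Literature.NumberTheory.Automorphic

end
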